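import Summits.MatrixMultiplication.MatrixMultiplication.Theorems.SaturationLadderBaseFamily
import HarnessLib

/-!
# SaturationLadder — the base ladder's theorem frontier IS the family constant `θ_F = 2^{47/30} = 2.9622…`

Route `SaturationLadder` (sub-problem `MatrixMultiplication`), crux `SubexpSaturation`
(stmt-MatrixMultiplication-25909) `⟺ ∀ θ > 1, Base(θ)` (`SaturationLadderBaseFamily.subexpSaturation_iff_forall_base`),
where `Base(θ) :≡ ∃ C, ∀ t ∈ [0,1), ∃ r, 1 ≤ r ≤ C · θ^{1/(1−t)} ∧ ω(1,t,r) ≤ 1 + r` (written out verbatim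
below; no definition is introduced).

The landed grades are `Base(4)` (Coppersmith–Winograd), `Base(3)` (twin) and `Base(θ)` for every `θ ≥ 2.97`
(`base_of_ge_297`, from the STAGE-2 twin family of `Theorems/SaturationLadderTwinFamily.lean`).  The growth
comparison used there, `1/(1−t_j) = (j+1)(30j+37)/(47j+37) ≥ 30j/47`, is wasteful by a bounded factor; the
EXACT comparison is `(47/30)/(1 − t_j) ≥ j` for every `j` (it reads `47(j+1)(30j+37) − 30j(47j+37) = 2039j +
1739 ≥ 0`), so the SAME certificates give `Base(θ)` for every `θ ≥ θ_F := 2^{47/30}`, the constant of the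
family itself (`2^{j} = θ_F^{30j/47}`), and `2.962 < θ_F < 2.963`:

* `nat_le_family_exponent`   : `j ≤ (47/30) · 1/(1 − t_j)`;
* `two_pow_le_rpow_family`   : `2^j ≤ θ_F^{1/(1−t_j)}`;
* `saturationBase_family`    : `Base(θ_F)` with the explicit constant `C = r_1000`;
* `base_of_ge_family`        : `Base(θ)` for every `θ ≥ θ_F` — the theorem frontier of the base ladder;
* `family_lt_2963`, `lt_family_2962` : `2.962 < θ_F < 2.963` (so the gen-10 `base_of_ge_297` is a corollary);
* `subexpSaturation_iff_base_below_family` : **`SubexpSaturation ⟺ ∀ θ ∈ (1, θ_F), Base(θ)`** — the open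
  content of the crux is exactly the grades strictly below the family constant.

Below `θ_F` no certificate family is in the tree; the recorded in-class ceiling of twin-type designs is
`e^{c₂} = 2.90099` (route file, stmt-25909 docstring).  No named facts, no sorry (cell `decomp-mm`, lens 1
«grading / quantitative ladder», gen 11).
-/

set_option linter.dupNamespace false
-- (single-conjunct summit: the namespace repeats `MatrixMultiplication`)

noncomputable section

namespace Summit.MatrixMultiplication.MatrixMultiplication.Theorems.SaturationLadderFamilyConstant

open Literature.Computability.AlgebraicComplexity
open Summit.MatrixMultiplication.MatrixMultiplication.Theorems.SaturationLadderTwinExact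
  (omegaRect_one_tw_exact)
open Summit.MatrixMultiplication.MatrixMultiplication.Theorems.SaturationLadderTwinFamily
open Summit.MatrixMultiplication.MatrixMultiplication.Theorems.SaturationLadderTwinFamilyX
  (familyX)
open Summit.MatrixMultiplication.MatrixMultiplication.Theorems.SaturationLadderTwinSaturation
  (familyY)
open Summit.MatrixMultiplication.MatrixMultiplication.Theorems.SaturationLadderSubThreeSaturation
  (baseSaturation_of_certificates)
open Summit.MatrixMultiplication.MatrixMultiplication.Theses.SaturationLadder
  (SubexpSaturation)
open Summit.MatrixMultiplication.MatrixMultiplication.Theorems.SaturationLadderBaseFamily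
  (base_mono subexpSaturation_iff_forall_base)

/-! ## The family constant `θ_F = 2^{47/30}` -/

/-- `1 < 2^{47/30}`. [folklore] -/
theorem one_lt_family : (1 : ℝ) < (2 : ℝ) ^ ((47 : ℝ) / 30) :=
  Real.one_lt_rpow (by norm_num) (by norm_num)

/-- `(2^{47/30})^{30} = 2^{47}`. [folklore] -/
theorem family_pow_thirty : ((2 : ℝ) ^ ((47 : ℝ) / 30)) ^ (30 : ℕ) = (2 : ℝ) ^ (47 : ℕ) := by
  rw [← Real.rpow_natCast _ 30, ← Real.rpow_mul (by norm_num : (0 : ℝ) ≤ 2),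
    ← Real.rpow_natCast (2 : ℝ) 47]
  congr 1; push_cast; norm_num

/-- `2^{47/30} < 2.963` (`2^{47} < 2.963^{30}`). [folklore] -/
theorem family_lt_2963 : (2 : ℝ) ^ ((47 : ℝ) / 30) < 2963 / 1000 := by
  have h : ((2 : ℝ) ^ ((47 : ℝ) / 30)) ^ (30 : ℕ) < (2963 / 1000 : ℝ) ^ (30 : ℕ) := by
    rw [family_pow_thirty]; norm_num
  exact lt_of_pow_lt_pow_left₀ 30 (by norm_num) h

/-- `2.962 < 2^{47/30}` (`2.962^{30} < 2^{47}`). [folklore] -/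
theorem lt_family_2962 : (2962 / 1000 : ℝ) < (2 : ℝ) ^ ((47 : ℝ) / 30) := by
  have h : (2962 / 1000 : ℝ) ^ (30 : ℕ) < ((2 : ℝ) ^ ((47 : ℝ) / 30)) ^ (30 : ℕ) := by
    rw [family_pow_thirty]; norm_num
  exact lt_of_pow_lt_pow_left₀ 30 (by positivity) h

/-! ## The exact growth comparison along the STAGE-2 family -/

/-- `j ≤ (47/30) · 1/(1 − t_j)`, i.e. `30 j (47j+37) ≤ 47 (j+1)(30j+37)` (difference `2039j + 1739`).
[folklore] -/
theorem nat_le_family_exponent (j : ℕ) : (j : ℝ) ≤ (47 : ℝ) / 30 * (1 / (1 - fT j)) := by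
  rw [one_sub_fT, one_div_div, div_mul_div_comm, le_div_iff₀ (by positivity)]
  nlinarith [(Nat.cast_nonneg j : (0 : ℝ) ≤ j)]

/-- `2^j ≤ (2^{47/30})^{1/(1 − t_j)}` for every `j`. [folklore] -/
theorem two_pow_le_rpow_family (j : ℕ) :
    (2 : ℝ) ^ j ≤ ((2 : ℝ) ^ ((47 : ℝ) / 30)) ^ (1 / (1 - fT j)) := by
  rw [← Real.rpow_mul (by norm_num : (0 : ℝ) ≤ 2), ← Real.rpow_natCast (2 : ℝ) j]
  exact Real.rpow_le_rpow_of_exponent_le (by norm_num : (1 : ℝ) ≤ 2) (nat_le_family_exponent j)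

/-! ## The rung at the family constant and the frontier -/

/-- **`Base(2^{47/30})`**: there is `C` (here `C = r_1000`) such that for every `t ∈ [0, 1)` some
`r ∈ [1, C · (2^{47/30})^{1/(1−t)}]` has `ω(1, t, r) ≤ 1 + r` — the STAGE-2 twin certificates
`ω(1, t_j, r_j) = 1 + r_j` (`familyX`, `familyY` landed) read with the exact growth comparison
`r_{j+1} ≤ 2^{j+2} ≤ r_1000 · θ_F^{1/(1−t_j)}`.
[cite: CoppersmithWinograd1990, §8] [cite: AlmanDuanVassilevskaWilliamsXuXuZhou2025, Thm. 3.2, §3.4] -/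
theorem saturationBase_family :
    ∃ C : ℝ, ∀ t : ℝ, 0 ≤ t → t < 1 →
      ∃ r : ℝ, 1 ≤ r ∧ r ≤ C * ((2 : ℝ) ^ ((47 : ℝ) / 30)) ^ (1 / (1 - t)) ∧
        omegaRect ℂ 1 t r ≤ 1 + r := by
  have hθ1 : (1 : ℝ) ≤ (2 : ℝ) ^ ((47 : ℝ) / 30) := one_lt_family.le
  refine ⟨fR 1000, baseSaturation_of_certificates ((2 : ℝ) ^ ((47 : ℝ) / 30)) (fR 1000) hθ1
    (fun k => fT (1000 + k)) (fun k => fR (1000 + k)) (fun k => one_le_fR (1000 + k) (by omega))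
    (fun k => ?_) (fun s hs => ?_) ?_ (fun k => ?_)⟩
  · -- each member is an exact certificate (`familyX`, `familyY` landed)
    exact omegaRect_one_tw_exact (1000 + k) (fN₁ (1000 + k)) (fN₂ (1000 + k)) (fN₃ (1000 + k))
      (fN₄ (1000 + k)) 0 (fN₆ (1000 + k)) (by unfold fN₆; omega)
      (fN₁_add_fN₄ (1000 + k) (by omega)) (fN₂_add_fN₃ (1000 + k) (by omega))
      (by unfold fN₃; positivity) (familyX (1000 + k) (by omega)) (familyY (1000 + k) (by omega))
  · -- the abscissae exhaust `[0,1)`: `1 − t_j ≤ 2/j`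
    obtain ⟨k, hk⟩ := exists_nat_ge (2 / (1 - s))
    refine ⟨k, ?_⟩
    have h1s : 0 < 1 - s := by linarith
    have hjpos : (0 : ℝ) < ((1000 + k : ℕ) : ℝ) := by positivity
    have hle := one_sub_fT_le (1000 + k) (by omega)
    have hk' : 2 / (1 - s) ≤ ((1000 + k : ℕ) : ℝ) := hk.trans (by push_cast; linarith)
    have h2 : 2 / ((1000 + k : ℕ) : ℝ) ≤ 1 - s := by
      rw [div_le_iff₀ hjpos]
      have := (div_le_iff₀ h1s).1 hk'
      linarith
    show s ≤ fT (1000 + k)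
    linarith
  · -- `r_1000 ≤ θ_F · r_1000`
    show fR (1000 + 0) ≤ (2 : ℝ) ^ ((47 : ℝ) / 30) * fR 1000
    rw [add_zero]
    nlinarith [one_le_fR 1000 (by norm_num)]
  · -- growth: `r_{j+1} ≤ 2^{j+2} = 4 · 2^j ≤ r_1000 · θ_F^{1/(1−t_j)}`
    show fR (1000 + (k + 1)) ≤ fR 1000 * ((2 : ℝ) ^ ((47 : ℝ) / 30)) ^ (1 / (1 - fT (1000 + k)))
    have h1 := fR_le (1000 + (k + 1)) (by omega)
    have h2 := two_pow_le_rpow_family (1000 + k)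
    have h3 := four_le_fR 1000 (by norm_num)
    have e : (2 : ℝ) ^ (1000 + (k + 1) + 1) = 4 * (2 : ℝ) ^ (1000 + k) := by
      rw [show 1000 + (k + 1) + 1 = (1000 + k) + 2 from by omega, pow_add, mul_comm]
      norm_num
    rw [e] at h1
    have h4 : (0 : ℝ) ≤ (2 : ℝ) ^ (1000 + k) := by positivity
    exact h1.trans (mul_le_mul h3 h2 h4 (by linarith))

/-- **The theorem frontier of the base ladder: `Base(θ)` for every `θ ≥ 2^{47/30} = 2.9622…`**
(monotonicity `base_mono` from `saturationBase_family`).  With `subexpSaturation_iff_forall_base`, the crux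
`SubexpSaturation` (stmt-25909) is the conjunction of the grades `θ ∈ (1, 2^{47/30})`, none of which has a
certificate in the tree. [cite: AlmanDuanVassilevskaWilliamsXuXuZhou2025, §3.4] -/
theorem base_of_ge_family {θ : ℝ} (hθ : (2 : ℝ) ^ ((47 : ℝ) / 30) ≤ θ) :
    ∃ C : ℝ, ∀ t : ℝ, 0 ≤ t → t < 1 →
      ∃ r : ℝ, 1 ≤ r ∧ r ≤ C * θ ^ (1 / (1 - t)) ∧ omegaRect ℂ 1 t r ≤ 1 + r :=
  base_mono (by positivity) hθ saturationBase_family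

/-- **The crux from the grades below the family constant**: if `Base(θ)` holds for every base `θ`
STRICTLY BETWEEN `1` and `2^{47/30}`, then `SubexpSaturation` (stmt-MatrixMultiplication-25909) — the grades at
and above `2^{47/30}` are theorems (`base_of_ge_family`) and the crux is the conjunction of all grades `θ > 1`
(`subexpSaturation_iff_forall_base`). [cite: AlmanDuanVassilevskaWilliamsXuXuZhou2025, §3.4] -/
theorem subexpSaturation_of_base_below_family
    (h : ∀ θ : ℝ, 1 < θ → θ < (2 : ℝ) ^ ((47 : ℝ) / 30) → ∃ C : ℝ, ∀ t : ℝ, 0 ≤ t → t < 1 →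
      ∃ r : ℝ, 1 ≤ r ∧ r ≤ C * θ ^ (1 / (1 - t)) ∧ omegaRect ℂ 1 t r ≤ 1 + r) :
    SubexpSaturation := by
  rw [subexpSaturation_iff_forall_base]
  intro θ hθ
  by_cases hlt : θ < (2 : ℝ) ^ ((47 : ℝ) / 30)
  · exact h θ hθ hlt
  · exact base_of_ge_family (not_lt.mp hlt)

/-- **The open content of the crux, exactly**: `SubexpSaturation ⟺ ∀ θ ∈ (1, 2^{47/30}), Base(θ)`.
[cite: AlmanDuanVassilevskaWilliamsXuXuZhou2025, §3.4] -/
theorem subexpSaturation_iff_base_below_family :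
    SubexpSaturation ↔ ∀ θ : ℝ, 1 < θ → θ < (2 : ℝ) ^ ((47 : ℝ) / 30) → ∃ C : ℝ, ∀ t : ℝ, 0 ≤ t → t < 1 →
      ∃ r : ℝ, 1 ≤ r ∧ r ≤ C * θ ^ (1 / (1 - t)) ∧ omegaRect ℂ 1 t r ≤ 1 + r :=
  ⟨fun h θ hθ _ => (subexpSaturation_iff_forall_base.1 h) θ hθ, subexpSaturation_of_base_below_family⟩

end Summit.MatrixMultiplication.MatrixMultiplication.Theorems.SaturationLadderFamilyConstant

end
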